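import Summits.ValiantsHypothesis.ValiantsHypothesis.Theorems.GrenetZeonDualUnipotentThreeHalvesFlagCostRunBound
import Summits.ValiantsHypothesis.ValiantsHypothesis.Theorems.GrenetZeonDualUnipotentThreeHalvesWordDefs

/-!
# `GrenetZeon.DualUnipotentThreeHalves` (stmt-ValiantsHypothesis-24318) — successor line `slow_core`: the POWER-CURRENCY VOCABULARY of record
# (`Slow`, `SlowR`, R2ᵖ `HeavyTopSlowLaw`, `IrrSlowLaw`, `RedSlowLaw`) re-landed for Theorems-side use, with the kernel bridges from flag currency

Lead prover val-port-2 g3 (names of record: `Cruxes/DualUnipotentThreeHalves/Lines/slow_core.lean` rev 1 @9979bf611188, REGISTERED — director-valiant g17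
R315 (1); critic of record val-idea-crit-7 g3 V25/V26).  Crux workfiles are not importable from `Theorems/`, so — exactly as ✓ `…WordDefs` does for line #1
`radical_split` — the DEFINITIONS of the successor skeleton are re-landed here VERBATIM (same names, same bodies; definitionally equal to their workfile twins,
so the line wires Theorems-side theorems about them by `exact`), over the Theorems twins ✓ `RadicalSplit.lineSubst` / `FlagCheap` / `pencilAlg` / `RadOrth` /
`HeavyTopLaw`.  WHY (director R306/R307/R310, val-idea-31 g4's observation, three legs R309 (3)): the node the crux consumes is S3 `SlowPlane` (only `N^{n−1}`);
the ratio knapsack `E(n)` that kills every flag/word/weight-currency sufficient condition on 24318 (R2-as-typed DEAD on paper, crit-7 23:10:34Z booking) is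
SLOW by cancellation — so the successor head is R2 with its conclusion moved to POWER currency.

* `Slow n m N` — S3's body for ONE pencil; `SlowR n m N` — WINDOW currency (all powers `b ≤ n − 1`; the currency in which absorption inducts, crit-7 V25 P-A1);
  `slow_of_slowR`; `totalDegree_pow_le_flagDeg_of_le` + ★ `slowR_of_flagCheap : FlagCheap n m N → SlowR n m N` (✓ `FlagCost.coeff_pow_of_flagAdapted` is uniform
  in the exponent); `slow_of_flagCheap`.
* R2ᵖ `HeavyTopSlowLaw` (the HEAD; LAW, OPEN; E(n) satisfies its conclusion with `k = 0`), `heavyTopSlowLaw_of_heavyTopLaw` (R2 ⇒ R2ᵖ, ✓ `runBound` per pencil);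
  `IrrSlowLaw` (IRR: `pencilAlg N = ⊤`; research, UNFED — its index feeder `IndexCoreLaw` is dead on paper, V26) and `RedSlowLaw` (RED: reducible locus; PARKED,
  price of record V25 E3) with the em-glue `heavyTopSlowLaw_of_irr_red`.
All laws are `Prop`s, NEVER asserted.  Honest framing: vocabulary + bridges (`--supports stmt-ValiantsHypothesis-24318 --as helper`); nothing here proves
R2ᵖ, IRR, RED, S3, the crux 24318, 8062 or `VP ≠ VNP` — all OPEN / NOT proved. [slow_core rev 1; val-idea-31 g4; crit-7 g3 V25]
-/

-- single-conjunct layout: Sub = Summit, duplicated namespace component intended (the name is mandated)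
set_option linter.dupNamespace false
set_option autoImplicit false

noncomputable section

namespace Summit.ValiantsHypothesis.ValiantsHypothesis.Theorems.GrenetZeon.SlowCore

open MvPolynomial Matrix
open scoped BigOperators
open Summit.ValiantsHypothesis.ValiantsHypothesis.Cruxes.TwoDimCoefficients.DimTwoCases (AffMat IsAffine)
open Summit.ValiantsHypothesis.ValiantsHypothesis.Theorems.GrenetZeon.RadicalSplit (lineSubst FlagCheap pencilAlg RadOrth HeavyTopLaw)

/-! ## §1 Power currency -/

/-- **`Slow n m N`** — the body of S3 `SlowPlane` for ONE pencil: a direction space `K` and an order `k` with `(k+1)·n < dim K` such that along every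
line `x + s·v`, `v ∈ K`, every entry of `N(x + s v)^{n−1}` has `s`-degree `≤ k`. [slow_core; val-idea-31 g4 (2); R306 (2)] -/
def Slow (n m : ℕ) (N : AffMat n m) : Prop :=
  ∃ (K : Submodule ℂ (Fin n × Fin n → ℂ)) (k : ℕ),
    (∀ x v : Fin n × Fin n → ℂ, v ∈ K → ∀ i j : Fin m, (((N.map (lineSubst x v)) ^ (n - 1)) i j).totalDegree ≤ k) ∧
    (k + 1) * n < Module.finrank ℂ K

/-- **`SlowR n m N`** — WINDOW currency: like `Slow` but bounding EVERY power `b ≤ n − 1` along the lines of `K` (the currency in which absorption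
inducts — bare `Slow` does not absorb, crit-7 V25 P-A1; free from `FlagCheap` by `slowR_of_flagCheap`). [slow_core rev 1 E1] -/
def SlowR (n m : ℕ) (N : AffMat n m) : Prop :=
  ∃ (K : Submodule ℂ (Fin n × Fin n → ℂ)) (k : ℕ),
    (∀ x v : Fin n × Fin n → ℂ, v ∈ K → ∀ b, b ≤ n - 1 → ∀ i j : Fin m, (((N.map (lineSubst x v)) ^ b) i j).totalDegree ≤ k) ∧
    (k + 1) * n < Module.finrank ℂ K

/-- `SlowR ⇒ Slow` (take `b = n − 1`). [slow_core] -/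
theorem slow_of_slowR {n m : ℕ} {N : AffMat n m} (h : SlowR n m N) : Slow n m N := by
  obtain ⟨K, k, hK, hdim⟩ := h
  exact ⟨K, k, fun x v hv i j => hK x v hv (n - 1) le_rfl i j, hdim⟩

/-- Potential bookkeeping for EVERY power `b ≤ n − 1` (✓ `FlagCost.coeff_pow_of_flagAdapted` is uniform in the exponent). [folklore] -/
theorem totalDegree_pow_le_flagDeg_of_le {m : ℕ} (lvl : Fin m → ℕ) (p r a n b : ℕ) (hb : b ≤ n - 1) (hl : ∀ i, lvl i < p)
    (M : Matrix (Fin m) (Fin m) (MvPolynomial (Fin 1) ℂ))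
    (h : ∀ (i j : Fin m) (d : Fin 1 →₀ ℕ), coeff d (M i j) ≠ 0 → (a + 1) * d 0 + lvl j ≤ lvl i + r) (i j : Fin m) :
    ((M ^ b) i j).totalDegree ≤ (p - 1 + r * (n - 1)) / (a + 1) := by
  rw [totalDegree]
  refine Finset.sup_le fun d hd => ?_
  have hne : coeff d ((M ^ b) i j) ≠ 0 := mem_support_iff.mp hd
  have e := Summit.ValiantsHypothesis.ValiantsHypothesis.Theorems.GrenetZeon.FlagCost.coeff_pow_of_flagAdapted lvl r a M h b i j d hne
  have hsum : (d.sum fun _ e => e) = d 0 := by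
    rw [Finsupp.sum_fintype _ _ (fun _ => rfl)]
    simp
  rw [hsum]
  rw [Nat.le_div_iff_mul_le (Nat.succ_pos a), mul_comm]
  have hi := hl i
  have hrb : r * b ≤ r * (n - 1) := Nat.mul_le_mul_left _ hb
  generalize (a + 1) * d 0 = A at e ⊢
  generalize r * (n - 1) = B at e hrb ⊢
  generalize r * b = B' at e hrb
  omega

/-- ★ **`FlagCheap ⇒ SlowR`** (the run bound ✓ `FlagCost.runBound` for every power `b ≤ n − 1`; same flag, same `K`, same budget). [slow_core rev 1 E1] -/
theorem slowR_of_flagCheap {n m : ℕ} (N : AffMat n m) (h : FlagCheap n m N) : SlowR n m N := by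
  obtain ⟨K, k, hadapt, hdim⟩ := h
  refine ⟨K, k, ?_, hdim⟩
  intro x v hv b hb i j
  obtain ⟨g, lvl, p, r, a, hl, hk, hA⟩ := hadapt x v hv
  set N' := N.map (lineSubst x v) with hN'
  set G : Matrix (Fin m) (Fin m) (MvPolynomial (Fin 1) ℂ) := (g : Matrix (Fin m) (Fin m) ℂ).map C with hG
  set G' : Matrix (Fin m) (Fin m) (MvPolynomial (Fin 1) ℂ) := (↑g⁻¹ : Matrix (Fin m) (Fin m) ℂ).map C with hG'
  have hGG : G' * G = 1 := by
    rw [hG, hG', ← Matrix.map_mul, Units.inv_mul, Matrix.map_one _ C_0 C_1]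
  have hdegA : ∀ a' b', (((G * N' * G') ^ b) a' b').totalDegree ≤ k := fun a' b' =>
    (totalDegree_pow_le_flagDeg_of_le lvl p r a n b hb hl _ hA a' b').trans hk
  have hconj : N' ^ b = G' * (G * N' * G') ^ b * G :=
    (Summit.ValiantsHypothesis.ValiantsHypothesis.Theorems.GrenetZeon.FlagCost.conj_pow_eq G G' N' hGG b).symm
  rw [hconj]
  exact Summit.ValiantsHypothesis.ValiantsHypothesis.Theorems.GrenetZeon.FlagCost.totalDegree_conj_le
    (g : Matrix (Fin m) (Fin m) ℂ) (↑g⁻¹ : Matrix (Fin m) (Fin m) ℂ) ((G * N' * G') ^ b) hdegA i j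

/-- `FlagCheap ⇒ Slow` (✓ `runBound`, per pencil). -/
theorem slow_of_flagCheap {n m : ℕ} (N : AffMat n m) (h : FlagCheap n m N) : Slow n m N :=
  slow_of_slowR (slowR_of_flagCheap N h)

/-! ## §2 The laws of the successor line (Props, never asserted) -/

/-- **R2ᵖ — HEAVY-TOP SLOW LAW** (the HEAD of `slow_core`; LAW tier, OPEN): below `C₀m² < n³`, an affine nilpotent pencil all of whose trace-orthogonal
direction spaces are small is SLOW.  R2 ⇒ R2ᵖ; E(n) and E♮(n) satisfy its conclusion (k = 0 resp. SlowR k ≤ 2h−2); enemy list EMPTY (V25/V26).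
[slow_core; R306 (2)] -/
def HeavyTopSlowLaw : Prop :=
  ∃ C₀ n₀ : ℕ, ∀ n ≥ n₀, ∀ m : ℕ, C₀ * m ^ 2 < n ^ 3 → ∀ N : AffMat n m, IsAffine N → N ^ m = 0 →
    (∀ K : Submodule ℂ (Fin n × Fin n → ℂ), RadOrth n m N K →
      Module.finrank ℂ K ≤ 16 * m * Nat.sqrt n + 16 * n) →
    Slow n m N

/-- **IRR** — R2ᵖ on the irreducible locus `pencilAlg N = ⊤` (research stub of `slow_core`, UNFED: its index feeder `IndexCoreLaw` is dead on paper, V26).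
[slow_core] -/
def IrrSlowLaw : Prop :=
  ∃ C₀ n₀ : ℕ, ∀ n ≥ n₀, ∀ m : ℕ, C₀ * m ^ 2 < n ^ 3 → ∀ N : AffMat n m, IsAffine N → N ^ m = 0 →
    (∀ K : Submodule ℂ (Fin n × Fin n → ℂ), RadOrth n m N K →
      Module.finrank ℂ K ≤ 16 * m * Nat.sqrt n + 16 * n) →
    pencilAlg N = ⊤ → Slow n m N

/-- **RED** — R2ᵖ on the reducible locus `pencilAlg N ≠ ⊤` (parked stub of `slow_core`; price of record crit-7 V25 E3: RED = S3 ∖ IRR, common-`K` ledger,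
RED-LONG needs a MASS-RELATIVE law). [slow_core] -/
def RedSlowLaw : Prop :=
  ∃ C₀ n₀ : ℕ, ∀ n ≥ n₀, ∀ m : ℕ, C₀ * m ^ 2 < n ^ 3 → ∀ N : AffMat n m, IsAffine N → N ^ m = 0 →
    (∀ K : Submodule ℂ (Fin n × Fin n → ℂ), RadOrth n m N K →
      Module.finrank ℂ K ≤ 16 * m * Nat.sqrt n + 16 * n) →
    pencilAlg N ≠ ⊤ → Slow n m N

/-- **R2 ⇒ R2ᵖ** (✓ `runBound` per pencil).  The converse fails («slow only by cancellation»: E(n)). [slow_core] -/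
theorem heavyTopSlowLaw_of_heavyTopLaw (h : HeavyTopLaw) : HeavyTopSlowLaw := by
  obtain ⟨C₀, n₀, h⟩ := h
  exact ⟨C₀, n₀, fun n hn m hreg N hN hnil htop => slow_of_flagCheap N (h n hn m hreg N hN hnil htop)⟩

/-- **GLUE** (excluded middle on `pencilAlg N = ⊤`; constants = max). [slow_core] -/
theorem heavyTopSlowLaw_of_irr_red (hI : IrrSlowLaw) (hR : RedSlowLaw) : HeavyTopSlowLaw := by
  obtain ⟨Ci, ni, hi⟩ := hI
  obtain ⟨Cr, nr, hr⟩ := hR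
  refine ⟨max Ci Cr, max ni nr, fun n hn m hreg N hN hnil htop => ?_⟩
  have hregi : Ci * m ^ 2 < n ^ 3 := lt_of_le_of_lt (Nat.mul_le_mul_right _ (le_max_left _ _)) hreg
  have hregr : Cr * m ^ 2 < n ^ 3 := lt_of_le_of_lt (Nat.mul_le_mul_right _ (le_max_right _ _)) hreg
  by_cases hirr : pencilAlg N = ⊤
  · exact hi n (le_trans (le_max_left _ _) hn) m hregi N hN hnil htop hirr
  · exact hr n (le_trans (le_max_right _ _) hn) m hregr N hN hnil htop hirr

end Summit.ValiantsHypothesis.ValiantsHypothesis.Theorems.GrenetZeon.SlowCore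

end
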